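import Literature.Computability.QuantumComplexity.EntropyCeiling
import HarnessLib

/-!
# Adaptive shots floor: closed-loop circuit choice buys no shots against the entropy ceiling

**Object (new).** A CLOSED-LOOP single-copy strategy: a request map `S : List (ι → Bool) → R` choosing the next
circuit request `r ∈ R` from the list of computational-basis read-outs obtained so far, played for `N` shots
against an ARM `a : R → (ι → Bool) → ℝ` (the answer kernel: the read-out law of the state the arm returns on
request `r`). Its transcript law `adaptiveLaw a N S` on `Fin N → (ι → Bool)` is the DEPENDENT product
`a (S []) x₀ · a (S [x₀]) x₁ · a (S [x₀, x₁]) x₂ ⋯` (definition by recursion on `N`; the one-step split of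
`Fin (N+1) → A` is the explicit equivalence `consSplit`). The open-loop schedules of
`MitigationSampleFloor.transcriptLaw` (constant `S`) and the one-shot records R6/R7 of `EntropyCeiling`
(`N = 1`) are faces of this object, stated in prose only (this module imports neither face's module but
`EntropyCeiling`).

**Records.** A1 `adaptiveLaw_nonneg` / `sum_adaptiveLaw`; A2 `klUnif_succ` — the KL CHAIN RULE against the uniform law:
`D(P_{N+1} ‖ u^{⊗(N+1)}) = D(a (S []) ‖ u) + Σ_{x₀} a (S []) x₀ · D(P_N^{(x₀)} ‖ u^{⊗N})`, `P_N^{(x₀)}` the law of the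
history-shifted strategy `h ↦ S (x₀ :: h)` (zero cases explicit); A3 `klUnif_le_budget` — under the VISIBLE menu
hypothesis `∀ h, |h| < N → D(a (S h) ‖ u) ≤ b |h|`: `D ≤ Σ_{k<N} b k` WHATEVER the strategy; A4 `tvUnif_le_sqrt`
(the tree's `finitePinsker_holds`), `test_gap_le` / `adaptive_gap_le` (two arms, one strategy, `0 ≤ f ≤ 1` VISIBLE),
`klOne_outcomeProb_le` (`D(q_ρ ‖ u) ≤ n ln 2 − S(ρ)`: the tree's `kl_uniform_eq` + `measuredDeficiency_holds`) and
`deficiency_menu_le` (depth `≥ d` at rate `p`: budget `n ln 2 (1−p)^d`, the tree's `deficiencyCeiling_holds`); A5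
`adaptiveShots_floor` (per-step menus `b k`) and `adaptiveShots_floor_uniform : (1−2ε)² ≤ 2·(n ln 2)·N·(1−p)^d` for
EVERY closed-loop strategy (`ε ≤ 1/2` VISIBLE); A6 `window_rejects` / `adaptiveShots_floor_of_accuracy`
(`2δ < |t_A − t_B|` VISIBLE); A7 `numbers129` (`n = 100`, `p = 1/100`, `ε = 1/20`, `d = 1000` ⇒ `N ≥ 129`; at `ε = 1/10` the landed
`CoherentCopiesFloor.numbers100` gives `102` — by design the adaptive, coherent and open-loop floors give the SAME
numbers) and `example`s (`N = 2` law; `N = 1, 2` chain rules).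

**Dictionary (transfer).** Takagi–Tajima–Gu, Theorem 3 / Appendix F, bound the sample number of error
mitigation with a FIXED list of `N` distorted states through `D(⊗_k E(ψ_k) ‖ 𝟙/2^{NM}) = Σ_k D(E(ψ_k) ‖ 𝟙/2^M)`
(additivity, (F3)–(F4)). Here the `k`-th state is CHOSEN from the first `k−1` read-outs; additivity is replaced
by the chain rule for divergence (Polyanskiy–Wu, Theorem 2.15 / 2.16(c)) specialised to a uniform — hence
product — reference law, under which the conditional terms are bounded by the worst case of the step-`k` menu.
Everything downstream ((F5)–(F9): entropy ceiling per state, Pinsker, `[0,1]`-tests, `(1−2ε) ≤ 2·TV`) is the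
tree's `EntropyCeiling` records BY NAME at the ELEMENTARY rate `(1−p)^d` (print: `(1−γ)^{2L}`).

**HONEST SCOPE.** Classical closed-loop adaptivity ONLY: one fresh copy per shot, computational-basis read-out,
the next circuit request a function of past read-outs. NOT covered: coherent-and-adaptive protocols (general
instruments, quantum memory carried across shots), general POVMs per shot, resets / ancillas / mid-circuit
measurements inside a shot; `N` is fixed (data-dependent stopping is reduced to a fixed horizon by padding —
prose only, nothing typed); the rate is the tree's elementary `(1−p)` per layer; every statement is a LOWER
bound on `N` and is VACUOUS (right side `≥ (1−2ε)²`) at or below the useless depth; nothing is said about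
attaining the floor; no estimator, strategy or procedure is constructed; `BQP` vs `BPP` and every summit
statement are untouched. Expected grade: KNOWN mechanism · VARIANT (closed-loop) · RECORD.
-/

noncomputable section

namespace Literature.Computability.QuantumComplexity

namespace AdaptiveShotsFloor

open Matrix Finset
open scoped BigOperators ComplexOrder
open PauliPath EntropyCeiling

variable {ι : Type} [Fintype ι] [DecidableEq ι] {R : Type}

/-! ### §0 The object: closed-loop strategies and their transcript laws -/

/-- Splitting a transcript of `N+1` strings into its first string and the rest (`Fin.cons` / `Fin.tail`). [folklore] -/
private def consSplit (A : Type) (N : ℕ) : (Fin (N + 1) → A) ≃ A × (Fin N → A) where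
  toFun x := (x 0, Fin.tail x)
  invFun q := Fin.cons q.1 q.2
  left_inv x := by simp [Fin.cons_self_tail]
  right_inv q := by simp [Fin.tail_cons, Fin.cons_zero]

/-- **The transcript law of a closed-loop strategy.** An ARM `a : R → (ι → Bool) → ℝ` answers a request
`r` with a law on the `n`-bit strings; a STRATEGY `S : List (ι → Bool) → R` names the next request from the
history of strings read so far (most recent first). The law of the `N`-shot transcript is defined by peeling the
first shot: `P_S(x₀, t) = a(S [])(x₀) · P_{S|x₀}(t)` with the continuation strategy `S|x₀ = (h ↦ S (x₀ :: h))`.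
[cite: PolyanskiyWu2024, Theorem 2.16(c) eq. (2.26) (full chain rule: the law of `X^n` as a dependent product)] (the object; finite alphabets) -/
def adaptiveLaw (a : R → (ι → Bool) → ℝ) : (N : ℕ) → (List (ι → Bool) → R) → (Fin N → (ι → Bool)) → ℝ
  | 0, _, _ => 1
  | N + 1, S, x => a (S []) (x 0) * adaptiveLaw a N (fun h => S (x 0 :: h)) (Fin.tail x)

/-- The uniform law on `N`-shot transcripts: `(2^{-n})^N`. [cite: PolyanskiyWu2024, Theorem 2.2 (the uniform reference law `U_A`)] -/
def unifLaw (ι : Type) [Fintype ι] (N : ℕ) : ℝ := (((2 : ℝ) ^ Fintype.card ι)⁻¹) ^ N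

/-- `KL(P ‖ u^N) = Σ_x P(x) ln (P(x)/u^N)` on transcripts. [cite: PolyanskiyWu2024, Definition 2.1 (KL divergence), finite alphabet] -/
def klUnif (N : ℕ) (P : (Fin N → (ι → Bool)) → ℝ) : ℝ := ∑ x, P x * Real.log (P x / unifLaw ι N)

/-- One-shot divergence from the uniform law: `KL(q ‖ u)` (the tree's `kl_uniform_eq` left side). [cite: PolyanskiyWu2024, Definition 2.1 (KL divergence), finite alphabet] -/
def klOne (q : (ι → Bool) → ℝ) : ℝ := ∑ x, q x * Real.log (q x / ((2 : ℝ) ^ Fintype.card ι)⁻¹)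

omit [Fintype ι] [DecidableEq ι] in
/-- One step of the recursion: first answer times the law of the history-shifted strategy `h ↦ S (x₀ :: h)`.
[cite: PolyanskiyWu2024, Theorem 2.16(c) eq. (2.26) (dependent product law)] (definitional) -/
theorem adaptiveLaw_succ (a : R → (ι → Bool) → ℝ) (N : ℕ) (S : List (ι → Bool) → R) (x : Fin (N + 1) → (ι → Bool)) :
    adaptiveLaw a (N + 1) S x = a (S []) (x 0) * adaptiveLaw a N (fun h => S (x 0 :: h)) (Fin.tail x) := rfl

/-- Sums over `(N+1)`-shot transcripts split into the first shot and the rest. [folklore] -/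
private theorem sum_transcript_succ {N : ℕ} (F : (Fin (N + 1) → (ι → Bool)) → ℝ) :
    ∑ x, F x = ∑ x₀ : ι → Bool, ∑ t : Fin N → (ι → Bool), F (Fin.cons x₀ t) := by
  rw [← Fintype.sum_prod_type', ← (consSplit (ι → Bool) N).symm.sum_comp]
  rfl

omit [Fintype ι] [DecidableEq ι] in
/-- The transcript law is non-negative when every answer is. [cite: PolyanskiyWu2024, Theorem 2.16(c) (dependent product law)] (routine) -/
theorem adaptiveLaw_nonneg (a : R → (ι → Bool) → ℝ) (ha0 : ∀ r x, 0 ≤ a r x) :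
    ∀ (N : ℕ) (S : List (ι → Bool) → R) (x : Fin N → (ι → Bool)), 0 ≤ adaptiveLaw a N S x
  | 0, _, _ => zero_le_one
  | N + 1, _, _ => mul_nonneg (ha0 _ _) (adaptiveLaw_nonneg a ha0 N _ _)

/-- The transcript law is a probability law when every answer is. [cite: PolyanskiyWu2024, Theorem 2.16(c) (dependent product law)] (routine) -/
theorem sum_adaptiveLaw (a : R → (ι → Bool) → ℝ) (ha1 : ∀ r, ∑ x, a r x = 1) :
    ∀ (N : ℕ) (S : List (ι → Bool) → R), ∑ x, adaptiveLaw a N S x = 1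
  | 0, _ => by simp [adaptiveLaw]
  | N + 1, S => by
    rw [sum_transcript_succ]
    simp only [adaptiveLaw_succ, Fin.cons_zero, Fin.tail_cons]
    simp_rw [← Finset.mul_sum, sum_adaptiveLaw a ha1 N, mul_one]
    exact ha1 _

omit [DecidableEq ι] in
/-- The uniform transcript law is positive. [folklore] -/
private theorem unifLaw_pos (N : ℕ) : 0 < unifLaw ι N := pow_pos (inv_pos.2 (pow_pos two_pos _)) N

omit [DecidableEq ι] in
/-- One step of the uniform transcript law. [folklore] -/
private theorem unifLaw_succ (N : ℕ) : unifLaw ι (N + 1) = ((2 : ℝ) ^ Fintype.card ι)⁻¹ * unifLaw ι N := by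
  rw [unifLaw, unifLaw, pow_succ, mul_comm]

/-- The uniform transcript law sums to one. [folklore] -/
private theorem sum_unifLaw (N : ℕ) : ∑ _x : Fin N → (ι → Bool), unifLaw ι N = 1 := by
  rw [Finset.sum_const, Finset.card_univ, nsmul_eq_mul, Fintype.card_fun, Fintype.card_fin, Fintype.card_fun,
    Fintype.card_bool, unifLaw]
  rw [inv_pow, ← pow_mul]; push_cast
  rw [← pow_mul, mul_comm (Fintype.card ι) N]
  exact mul_inv_cancel₀ (pow_ne_zero _ two_ne_zero)

/-! ### §1 The chain rule for adaptively generated transcripts (the load-bearing lemma) -/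

/-- Pointwise splitting of the log of a product law against a product reference. [folklore] -/
private theorem mul_log_split {a L u v : ℝ} (hu : 0 < u) (hv : 0 < v) :
    a * L * Real.log (a * L / (u * v)) = a * L * Real.log (a / u) + a * L * Real.log (L / v) := by
  by_cases ha : a = 0
  · simp [ha]
  by_cases hL : L = 0
  · simp [hL]
  rw [mul_div_mul_comm, Real.log_mul (div_ne_zero ha hu.ne') (div_ne_zero hL hv.ne')]
  ring

/-- **KL chain rule for closed-loop transcripts.** For any arm of probability laws and any strategy,
`KL(P_S^{N+1} ‖ u^{N+1}) = KL(a(S []) ‖ u) + Σ_{x₀} a(S [])(x₀) · KL(P_{S|x₀}^{N} ‖ u^{N})`.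
[cite: PolyanskiyWu2024, Theorem 2.15 eq. (2.24) (chain rule for divergence) and Theorem 2.16(c) eq. (2.26)] (specialised to a uniform — product — reference law on a finite alphabet; the conditional term is the `a (S [])`-average of the divergences of the history-shifted strategies) -/
theorem klUnif_succ (a : R → (ι → Bool) → ℝ) (ha1 : ∀ r, ∑ x, a r x = 1)
    (N : ℕ) (S : List (ι → Bool) → R) :
    klUnif (N + 1) (adaptiveLaw a (N + 1) S) =
      klOne (a (S [])) + ∑ x₀, a (S []) x₀ * klUnif N (adaptiveLaw a N (fun h => S (x₀ :: h))) := by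
  rw [klUnif, sum_transcript_succ]
  simp only [adaptiveLaw_succ, Fin.cons_zero, Fin.tail_cons, unifLaw_succ]
  have hu : (0 : ℝ) < ((2 : ℝ) ^ Fintype.card ι)⁻¹ := inv_pos.2 (pow_pos two_pos _)
  have hv := unifLaw_pos (ι := ι) N
  simp_rw [mul_log_split hu hv, Finset.sum_add_distrib]
  congr 1
  · rw [klOne]
    refine Finset.sum_congr rfl fun x₀ _ => ?_
    simp_rw [mul_assoc, mul_comm (adaptiveLaw a N _ _) (Real.log _), ← mul_assoc, ← Finset.mul_sum,
      sum_adaptiveLaw a ha1 N, mul_one]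
  · refine Finset.sum_congr rfl fun x₀ _ => ?_
    rw [klUnif, Finset.mul_sum]
    refine Finset.sum_congr rfl fun t _ => ?_
    ring

/-! ### §2 The worst-case budget: adaptivity cannot beat the per-shot menu -/

/-- **Budget.** If every request the strategy can issue after a history of length `k` is answered by a law with
`KL(· ‖ u) ≤ b_k`, then `KL(P_S^N ‖ u^N) ≤ Σ_{k<N} b_k` — for EVERY closed-loop strategy.
[cite: PolyanskiyWu2024, Theorem 2.16(c) eq. (2.26)] [cite: QuekEtAl2024, p.16 («our bound holds against even an adaptive choice of observables»)] (worst case of the step-`k` menu; induction on `N`) -/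
theorem klUnif_le_budget (a : R → (ι → Bool) → ℝ) (ha0 : ∀ r x, 0 ≤ a r x) (ha1 : ∀ r, ∑ x, a r x = 1) :
    ∀ (N : ℕ) (S : List (ι → Bool) → R) (b : ℕ → ℝ),
      (∀ h : List (ι → Bool), h.length < N → klOne (a (S h)) ≤ b h.length) →
      klUnif N (adaptiveLaw a N S) ≤ ∑ k ∈ Finset.range N, b k
  | 0, S, b, _ => by simp [klUnif, adaptiveLaw, unifLaw]
  | N + 1, S, b, hb => by
    rw [klUnif_succ a ha1 N S, Finset.sum_range_succ']
    have h0 : klOne (a (S [])) ≤ b 0 := hb [] (by simp)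
    have hk : ∀ x₀, klUnif N (adaptiveLaw a N (fun h => S (x₀ :: h))) ≤ ∑ k ∈ Finset.range N, b (k + 1) := by
      intro x₀
      refine klUnif_le_budget a ha0 ha1 N _ (fun k => b (k + 1)) fun h hh => ?_
      have := hb (x₀ :: h) (by simpa using hh)
      simpa using this
    have hsum : ∑ x₀, a (S []) x₀ * klUnif N (adaptiveLaw a N (fun h => S (x₀ :: h))) ≤
        ∑ k ∈ Finset.range N, b (k + 1) := by
      calc ∑ x₀, a (S []) x₀ * klUnif N (adaptiveLaw a N (fun h => S (x₀ :: h)))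
          ≤ ∑ x₀, a (S []) x₀ * ∑ k ∈ Finset.range N, b (k + 1) :=
            Finset.sum_le_sum fun x₀ _ => mul_le_mul_of_nonneg_left (hk x₀) (ha0 _ _)
        _ = ∑ k ∈ Finset.range N, b (k + 1) := by rw [← Finset.sum_mul, ha1, one_mul]
    linarith

/-! ### §3 Pinsker, total variation, and the two-arm test gap -/

/-- Total variation from the uniform transcript law: `½ Σ_x |P(x) − u^N|`. [cite: PolyanskiyWu2024, §7.1 (total variation, `f(x) = ½|x−1|`)] -/
def tvUnif (N : ℕ) (P : (Fin N → (ι → Bool)) → ℝ) : ℝ := (∑ x, |P x - unifLaw ι N|) / 2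

/-- **Pinsker on transcripts.** `TV(P, u^N) ≤ √(KL(P ‖ u^N)/2)` (the tree's `finitePinsker_holds`). [cite: PolyanskiyWu2024, Theorem 7.10 (Pinsker's inequality)] -/
theorem tvUnif_le_sqrt (N : ℕ) (P : (Fin N → (ι → Bool)) → ℝ) (hP0 : ∀ x, 0 ≤ P x) (hP1 : ∑ x, P x = 1) :
    tvUnif N P ≤ Real.sqrt (klUnif N P / 2) := by
  have hpin := finitePinsker_holds (Fin N → (ι → Bool)) P (fun _ => unifLaw ι N) hP0 (fun _ => unifLaw_pos N) hP1
    (sum_unifLaw N)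
  have hS0 : 0 ≤ ∑ x, |P x - unifLaw ι N| := Finset.sum_nonneg fun x _ => abs_nonneg _
  rw [tvUnif]
  have hkl : (∑ x, |P x - unifLaw ι N|) ^ 2 / 4 ≤ klUnif N P / 2 := by rw [klUnif]; linarith
  calc (∑ x, |P x - unifLaw ι N|) / 2 = Real.sqrt (((∑ x, |P x - unifLaw ι N|) / 2) ^ 2) := by
        rw [Real.sqrt_sq (by positivity)]
    _ ≤ Real.sqrt (klUnif N P / 2) := Real.sqrt_le_sqrt (by rw [div_pow]; norm_num; exact hkl)

/-- A `[0,1]`-valued statistic separates two probability laws by at most their total variation through `u^N`.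
[cite: PolyanskiyWu2024, Theorem 7.7(a) eqs. (7.18)–(7.19) (sup-representation of TV; minimal total error `1 − TV`)] (triangle through the uniform law) -/
theorem test_gap_le (N : ℕ) (P Q : (Fin N → (ι → Bool)) → ℝ) (hP1 : ∑ x, P x = 1) (hQ1 : ∑ x, Q x = 1)
    (f : (Fin N → (ι → Bool)) → ℝ) (hf0 : ∀ x, 0 ≤ f x) (hf1 : ∀ x, f x ≤ 1) :
    |∑ x, P x * f x - ∑ x, Q x * f x| ≤ tvUnif N P + tvUnif N Q := by
  have key : ∀ (P' : (Fin N → (ι → Bool)) → ℝ), ∑ x, P' x = 1 →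
      |∑ x, P' x * f x - ∑ x, unifLaw ι N * f x| ≤ tvUnif N P' := by
    intro P' hP'
    have hre : ∑ x, P' x * f x - ∑ x, unifLaw ι N * f x = ∑ x, (P' x - unifLaw ι N) * (f x - 1 / 2) := by
      have h1 : ∑ x, (P' x - unifLaw ι N) = 0 := by
        rw [Finset.sum_sub_distrib, hP', sum_unifLaw N, sub_self]
      have h2 : ∑ x, (P' x - unifLaw ι N) * (f x - 1 / 2) =
          ∑ x, (P' x * f x - unifLaw ι N * f x) - (1 / 2) * ∑ x, (P' x - unifLaw ι N) := by
        rw [Finset.mul_sum, ← Finset.sum_sub_distrib]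
        exact Finset.sum_congr rfl fun x _ => by ring
      rw [h2, h1, mul_zero, sub_zero, Finset.sum_sub_distrib]
    rw [hre, tvUnif]
    calc |∑ x, (P' x - unifLaw ι N) * (f x - 1 / 2)| ≤ ∑ x, |(P' x - unifLaw ι N) * (f x - 1 / 2)| :=
          Finset.abs_sum_le_sum_abs _ _
      _ ≤ ∑ x, |P' x - unifLaw ι N| * (1 / 2) := by
          refine Finset.sum_le_sum fun x _ => ?_
          rw [abs_mul]
          exact mul_le_mul_of_nonneg_left (abs_le.2 ⟨by linarith [hf0 x], by linarith [hf1 x]⟩) (abs_nonneg _)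
      _ = (∑ x, |P' x - unifLaw ι N|) / 2 := by rw [← Finset.sum_mul]; ring
  have hA := key P hP1
  have hB := key Q hQ1
  calc |∑ x, P x * f x - ∑ x, Q x * f x|
      = |(∑ x, P x * f x - ∑ x, unifLaw ι N * f x) - (∑ x, Q x * f x - ∑ x, unifLaw ι N * f x)| := by ring_nf
    _ ≤ |∑ x, P x * f x - ∑ x, unifLaw ι N * f x| + |∑ x, Q x * f x - ∑ x, unifLaw ι N * f x| := abs_sub _ _
    _ ≤ tvUnif N P + tvUnif N Q := add_le_add hA hB

/-- **The adaptive two-arm test gap.** Two arms answering the SAME closed-loop strategy with per-step budgets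
`b^A_k`, `b^B_k`: every `[0,1]`-statistic of the transcript differs in mean by at most `√(Σ b^A/2) + √(Σ b^B/2)`.
[cite: TakagiTajimaGu2023, Appendix F eqs. (F2)–(F4) p.26 (the fixed-circuit case)] (closed-loop version: chain rule in place of additivity) -/
theorem adaptive_gap_le (aA aB : R → (ι → Bool) → ℝ) (hA0 : ∀ r x, 0 ≤ aA r x) (hA1 : ∀ r, ∑ x, aA r x = 1)
    (hB0 : ∀ r x, 0 ≤ aB r x) (hB1 : ∀ r, ∑ x, aB r x = 1) (N : ℕ) (S : List (ι → Bool) → R) (bA bB : ℕ → ℝ)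
    (hbA : ∀ h : List (ι → Bool), h.length < N → klOne (aA (S h)) ≤ bA h.length)
    (hbB : ∀ h : List (ι → Bool), h.length < N → klOne (aB (S h)) ≤ bB h.length)
    (f : (Fin N → (ι → Bool)) → ℝ) (hf0 : ∀ x, 0 ≤ f x) (hf1 : ∀ x, f x ≤ 1) :
    |∑ x, adaptiveLaw aA N S x * f x - ∑ x, adaptiveLaw aB N S x * f x| ≤
      Real.sqrt ((∑ k ∈ Finset.range N, bA k) / 2) + Real.sqrt ((∑ k ∈ Finset.range N, bB k) / 2) := by
  have h1 := test_gap_le N _ _ (sum_adaptiveLaw aA hA1 N S) (sum_adaptiveLaw aB hB1 N S) f hf0 hf1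
  have h2 := tvUnif_le_sqrt N _ (adaptiveLaw_nonneg aA hA0 N S) (sum_adaptiveLaw aA hA1 N S)
  have h3 := tvUnif_le_sqrt N _ (adaptiveLaw_nonneg aB hB0 N S) (sum_adaptiveLaw aB hB1 N S)
  have h4 : Real.sqrt (klUnif N (adaptiveLaw aA N S) / 2) ≤ Real.sqrt ((∑ k ∈ Finset.range N, bA k) / 2) :=
    Real.sqrt_le_sqrt (by linarith [klUnif_le_budget aA hA0 hA1 N S bA hbA])
  have h5 : Real.sqrt (klUnif N (adaptiveLaw aB N S) / 2) ≤ Real.sqrt ((∑ k ∈ Finset.range N, bB k) / 2) :=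
    Real.sqrt_le_sqrt (by linarith [klUnif_le_budget aB hB0 hB1 N S bB hbB])
  linarith

/-! ### §4 Arms given by states: per-shot KL ≤ entropy deficiency; noisy-circuit menus -/

/-- The answer kernel of an arm that answers request `r` with the computational-basis read-out of the
state `ρ r`: `a r x = ⟨x|ρ r|x⟩` (the tree's `outcomeProb`). [cite: NielsenChuang2010, Theorem 11.9 p.515 (measurement in a fixed basis)] (plumbing) -/
def armLaw (ρ : R → Matrix (ι → Bool) (ι → Bool) ℂ) : R → (ι → Bool) → ℝ := fun r x => outcomeProb (ρ r) x

/-- **Per-shot budget.** The read-out law of a state `ρ` has `D(q_ρ ‖ u) = n ln 2 − H(q_ρ) ≤ n ln 2 − S(ρ) =`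
`entropyDeficiency ρ` (measuring does not decrease entropy, `measuredDeficiency_holds`; `kl_uniform_eq`).
[cite: NielsenChuang2010, Theorem 11.9 p.515] (via the tree's `measuredDeficiency_holds`) -/
theorem klOne_outcomeProb_le {ρ : Matrix (ι → Bool) (ι → Bool) ℂ} (hρ : IsDensity ρ) :
    klOne (outcomeProb ρ) ≤ entropyDeficiency ρ := by
  rw [klOne, kl_uniform_eq _ (sum_outcomeProb hρ), entropyDeficiency]
  linarith [measuredDeficiency_holds ι ρ hρ]

/-- **Adaptive test gap for state-valued arms (the general menu form).** Arms A and B answer request `r`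
with basis read-outs of the states `ρA r`, `ρB r`; ONE closed-loop strategy `S` drives both; if along every
history `h` the requested states obey the VISIBLE menu budgets `D(ρA (S h)) ≤ bA |h|`, `D(ρB (S h)) ≤ bB |h|`,
then for every statistic `0 ≤ f ≤ 1` of the transcript
`|E_A f − E_B f| ≤ √(Σ_{k<N} bA k / 2) + √(Σ_{k<N} bB k / 2)`.
[cite: TakagiTajimaGu2023, Theorem 3 / Appendix F (F2)–(F9) p.26–27] (there for FIXED circuit lists; here the
list is chosen in closed loop and the bound is unchanged) -/
theorem adaptive_gap_le_of_deficiency {ρA ρB : R → Matrix (ι → Bool) (ι → Bool) ℂ}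
    (hA : ∀ r, IsDensity (ρA r)) (hB : ∀ r, IsDensity (ρB r)) (N : ℕ) (S : List (ι → Bool) → R)
    (bA bB : ℕ → ℝ) (hbA : ∀ h : List (ι → Bool), h.length < N → entropyDeficiency (ρA (S h)) ≤ bA h.length)
    (hbB : ∀ h : List (ι → Bool), h.length < N → entropyDeficiency (ρB (S h)) ≤ bB h.length)
    (f : (Fin N → (ι → Bool)) → ℝ) (hf0 : ∀ x, 0 ≤ f x) (hf1 : ∀ x, f x ≤ 1) :
    |∑ x, adaptiveLaw (armLaw ρA) N S x * f x - ∑ x, adaptiveLaw (armLaw ρB) N S x * f x| ≤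
      Real.sqrt ((∑ k ∈ Finset.range N, bA k) / 2) + Real.sqrt ((∑ k ∈ Finset.range N, bB k) / 2) :=
  adaptive_gap_le (armLaw ρA) (armLaw ρB) (fun r => outcomeProb_nonneg (hA r)) (fun r => sum_outcomeProb (hA r))
    (fun r => outcomeProb_nonneg (hB r)) (fun r => sum_outcomeProb (hB r)) N S bA bB
    (fun h hh => (klOne_outcomeProb_le (hA _)).trans (hbA h hh))
    (fun h hh => (klOne_outcomeProb_le (hB _)).trans (hbB h hh)) f hf0 hf1

/-- **Noisy-circuit menu budget.** If request `r` is answered by the noisy circuit `noisyEvolve p (d r) (U r) (σ r)`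
(rate `p`, depth `d r ≥ d₀`, unitary layers, ANY input state), its entropy deficiency is `≤ n ln 2 · (1−p)^{d₀}` —
the tree's ELEMENTARY-rate ceiling `deficiencyCeiling_holds` (one factor `(1−p)` per layer; print has `(1−p)²`).
[cite: TakagiTajimaGu2023, Appendix F eq. (F5)–(F7) p.26] (elementary rate) -/
theorem deficiency_menu_le {p : ℝ} (hp0 : 0 ≤ p) (hp1 : p ≤ 1) {d : R → ℕ} {d₀ : ℕ} (hd : ∀ r, d₀ ≤ d r)
    {U : (r : R) → Fin (d r) → Matrix (ι → Bool) (ι → Bool) ℂ} (hU : ∀ r t, U r t ∈ Matrix.unitaryGroup (ι → Bool) ℂ)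
    {σ : R → Matrix (ι → Bool) (ι → Bool) ℂ} (hσ : ∀ r, IsDensity (σ r)) (r : R) :
    entropyDeficiency (noisyEvolve (p : ℂ) (d r) (U r) (σ r)) ≤ Fintype.card ι * Real.log 2 * (1 - p) ^ d₀ := by
  have h1 := deficiencyCeiling_holds ι p hp0 hp1 (d r) (U r) (hU r) (σ r) (hσ r)
  have h2 := entropyDeficiency_le (hσ r)
  have h3 : (0 : ℝ) ≤ (1 - p) ^ d r := pow_nonneg (by linarith) _
  have h4 : (1 - p) ^ d r ≤ (1 - p) ^ d₀ := pow_le_pow_of_le_one (by linarith) (by linarith) (hd r)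
  have h5 : (0 : ℝ) ≤ Fintype.card ι * Real.log 2 := by positivity
  calc entropyDeficiency (noisyEvolve (p : ℂ) (d r) (U r) (σ r)) ≤ (1 - p) ^ d r * entropyDeficiency (σ r) := h1
    _ ≤ (1 - p) ^ d r * (Fintype.card ι * Real.log 2) := mul_le_mul_of_nonneg_left h2 h3
    _ ≤ (1 - p) ^ d₀ * (Fintype.card ι * Real.log 2) := mul_le_mul_of_nonneg_right h4 h5
    _ = Fintype.card ι * Real.log 2 * (1 - p) ^ d₀ := by ring

/-! ### §5 The floors: every closed-loop strategy needs as many shots as an open-loop one -/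

/-- Squaring step: `0 ≤ 1 − 2ε ≤ √X + √X` gives `(1−2ε)² ≤ 4X`. [folklore] -/
private theorem sq_le_four_mul {ε X : ℝ} (hX0 : 0 ≤ X) (hε : ε ≤ 1 / 2) (h : 1 - 2 * ε ≤ Real.sqrt X + Real.sqrt X) :
    (1 - 2 * ε) ^ 2 ≤ 4 * X := by
  calc (1 - 2 * ε) ^ 2 ≤ (Real.sqrt X + Real.sqrt X) ^ 2 := pow_le_pow_left₀ (by linarith) h 2
    _ = 4 * X := by rw [← two_mul, mul_pow, Real.sq_sqrt hX0]; ring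

/-- **Adaptive shots floor — heterogeneous menus (state form).** If ONE closed-loop strategy `S`, reading `N`
single-copy basis shots, ACCEPTS arm A with probability `≥ 1−ε` and arm B with probability `≤ ε` (`ε ≤ 1/2`
VISIBLE) through some statistic `0 ≤ f ≤ 1`, and both arms obey the common per-step menu budget `b k` along
every history, then `(1−2ε)² ≤ 2 · Σ_{k<N} b k`. With `b k = n ln 2 (1−p_k)^{d_k}` this is the schedule budget
of the open-loop case — closed-loop choice of the next circuit buys nothing against the worst case of the menu.
[cite: TakagiTajimaGu2023, Theorem 3 p.4] (adaptive-schedule reading; elementary rate) -/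
theorem adaptiveShots_floor {ρA ρB : R → Matrix (ι → Bool) (ι → Bool) ℂ}
    (hA : ∀ r, IsDensity (ρA r)) (hB : ∀ r, IsDensity (ρB r)) (N : ℕ) (S : List (ι → Bool) → R) (b : ℕ → ℝ)
    (hb0 : ∀ k, 0 ≤ b k)
    (hbA : ∀ h : List (ι → Bool), h.length < N → entropyDeficiency (ρA (S h)) ≤ b h.length)
    (hbB : ∀ h : List (ι → Bool), h.length < N → entropyDeficiency (ρB (S h)) ≤ b h.length)
    (f : (Fin N → (ι → Bool)) → ℝ) (hf0 : ∀ x, 0 ≤ f x) (hf1 : ∀ x, f x ≤ 1) {ε : ℝ} (hε : ε ≤ 1 / 2)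
    (hAcc : 1 - ε ≤ ∑ x, adaptiveLaw (armLaw ρA) N S x * f x) (hRej : ∑ x, adaptiveLaw (armLaw ρB) N S x * f x ≤ ε) :
    (1 - 2 * ε) ^ 2 ≤ 2 * ∑ k ∈ Finset.range N, b k := by
  have h := adaptive_gap_le_of_deficiency hA hB N S b b hbA hbB f hf0 hf1
  have hgap : 1 - 2 * ε ≤ Real.sqrt ((∑ k ∈ Finset.range N, b k) / 2) + Real.sqrt ((∑ k ∈ Finset.range N, b k) / 2) := by
    have := le_abs_self (∑ x, adaptiveLaw (armLaw ρA) N S x * f x - ∑ x, adaptiveLaw (armLaw ρB) N S x * f x)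
    linarith
  have hX0 : (0 : ℝ) ≤ (∑ k ∈ Finset.range N, b k) / 2 := by
    have := Finset.sum_nonneg fun k (_ : k ∈ Finset.range N) => hb0 k
    linarith
  have := sq_le_four_mul hX0 hε hgap
  linarith

/-- **Adaptive shots floor — uniform noisy-circuit menu (headline).** Two arms, each answering EVERY request `r`
with a noisy circuit of rate `p` and depth `≥ d` (arm A: layers `UA r` on input `σA r`; arm B: `UB r` on `σB r`);
ONE closed-loop strategy choosing each next request from the read-outs so far; `N` shots; any statistic
`0 ≤ f ≤ 1`; acceptance `≥ 1−ε` on A and `≤ ε` on B with `ε ≤ 1/2` VISIBLE. Then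
`(1−2ε)² ≤ 2·(n ln 2)·N·(1−p)^d` — the SAME floor as for a fixed schedule. Vacuous (right side ≥ 1) unless
`(1−p)^d < 1/(2 n ln 2 · N)`, i.e. beyond the useless depth. LOWER bound only; nothing about attaining it.
[cite: TakagiTajimaGu2023, Theorem 3 p.4] (closed-loop schedules; elementary rate `d` where print has `2d`) -/
theorem adaptiveShots_floor_uniform {p : ℝ} (hp0 : 0 ≤ p) (hp1 : p ≤ 1) {d : ℕ} {dA dB : R → ℕ}
    (hdA : ∀ r, d ≤ dA r) (hdB : ∀ r, d ≤ dB r)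
    {UA : (r : R) → Fin (dA r) → Matrix (ι → Bool) (ι → Bool) ℂ} (hUA : ∀ r t, UA r t ∈ Matrix.unitaryGroup (ι → Bool) ℂ)
    {UB : (r : R) → Fin (dB r) → Matrix (ι → Bool) (ι → Bool) ℂ} (hUB : ∀ r t, UB r t ∈ Matrix.unitaryGroup (ι → Bool) ℂ)
    {σA σB : R → Matrix (ι → Bool) (ι → Bool) ℂ} (hσA : ∀ r, IsDensity (σA r)) (hσB : ∀ r, IsDensity (σB r))
    (N : ℕ) (S : List (ι → Bool) → R) (f : (Fin N → (ι → Bool)) → ℝ) (hf0 : ∀ x, 0 ≤ f x) (hf1 : ∀ x, f x ≤ 1)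
    {ε : ℝ} (hε : ε ≤ 1 / 2)
    (hAcc : 1 - ε ≤ ∑ x, adaptiveLaw (armLaw fun r => noisyEvolve (p : ℂ) (dA r) (UA r) (σA r)) N S x * f x)
    (hRej : ∑ x, adaptiveLaw (armLaw fun r => noisyEvolve (p : ℂ) (dB r) (UB r) (σB r)) N S x * f x ≤ ε) :
    (1 - 2 * ε) ^ 2 ≤ 2 * (Fintype.card ι * Real.log 2) * N * (1 - p) ^ d := by
  have h := adaptiveShots_floor (fun r => isDensity_noisyEvolve hp0 hp1 (dA r) (UA r) (hUA r) (hσA r))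
    (fun r => isDensity_noisyEvolve hp0 hp1 (dB r) (UB r) (hUB r) (hσB r)) N S
    (fun _ => Fintype.card ι * Real.log 2 * (1 - p) ^ d)
    (fun _ => by have : (0:ℝ) ≤ (1 - p) ^ d := pow_nonneg (by linarith) _; positivity)
    (fun h _ => deficiency_menu_le hp0 hp1 hdA hUA hσA (S h))
    (fun h _ => deficiency_menu_le hp0 hp1 hdB hUB hσB (S h)) f hf0 hf1 hε hAcc hRej
  simpa [Finset.sum_const, Finset.card_range, mul_comm, mul_left_comm, mul_assoc] using h

/-! ### §6 The accuracy reading: `(δ, ε)`-estimation of two targets more than `2δ` apart -/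

/-- **Estimation ⇒ test.** If a closed-loop strategy's real answer `g` (any function of the transcript) is
`δ`-close to `tA` with probability `≥ 1−ε` under arm A and `δ`-close to `tB` with probability `≥ 1−ε` under arm B,
and `2δ < |tA − tB|` (VISIBLE), then the window indicator of `tA` is a statistic accepted `≥ 1−ε` on A and `≤ ε`
on B — so every floor of §5 applies to the estimation task.
[cite: TakagiTajimaGu2023, Theorem 3 p.4 (hypothesis (1): δ ≥ 0, 0 ≤ ε ≤ 1/2, targets ≥ 2δ apart)] -/
theorem window_rejects (N : ℕ) (Q : (Fin N → (ι → Bool)) → ℝ) (hQ0 : ∀ x, 0 ≤ Q x) (hQ1 : ∑ x, Q x = 1)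
    (g : (Fin N → (ι → Bool)) → ℝ) {tA tB δ ε : ℝ} (hsep : 2 * δ < |tA - tB|)
    (hAccB : 1 - ε ≤ ∑ x, Q x * (if |g x - tB| ≤ δ then 1 else 0)) :
    ∑ x, Q x * (if |g x - tA| ≤ δ then 1 else 0) ≤ ε := by
  have hdisj : ∀ x, (if |g x - tA| ≤ δ then (1:ℝ) else 0) + (if |g x - tB| ≤ δ then 1 else 0) ≤ 1 := by
    intro x
    by_cases h1 : |g x - tA| ≤ δ
    · by_cases h2 : |g x - tB| ≤ δ
      · exfalso
        have : |tA - tB| ≤ 2 * δ := by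
          calc |tA - tB| = |(g x - tB) - (g x - tA)| := by ring_nf
            _ ≤ |g x - tB| + |g x - tA| := abs_sub _ _
            _ ≤ 2 * δ := by linarith
        linarith
      · simp [h1, h2]
    · by_cases h2 : |g x - tB| ≤ δ <;> simp [h1, h2]
  have hle : ∑ x, Q x * (if |g x - tA| ≤ δ then (1:ℝ) else 0) + ∑ x, Q x * (if |g x - tB| ≤ δ then 1 else 0) ≤ 1 := by
    calc ∑ x, Q x * (if |g x - tA| ≤ δ then (1:ℝ) else 0) + ∑ x, Q x * (if |g x - tB| ≤ δ then 1 else 0)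
        = ∑ x, Q x * ((if |g x - tA| ≤ δ then (1:ℝ) else 0) + (if |g x - tB| ≤ δ then 1 else 0)) := by
          rw [← Finset.sum_add_distrib]; exact Finset.sum_congr rfl fun x _ => by ring
      _ ≤ ∑ x, Q x * 1 := Finset.sum_le_sum fun x _ => mul_le_mul_of_nonneg_left (hdisj x) (hQ0 x)
      _ = 1 := by simp [hQ1]
  linarith

/-- **Adaptive shots floor for `(δ, ε)`-estimation (uniform menu).** Any closed-loop single-copy strategy whose
answer `g` is `δ`-accurate with probability `≥ 1−ε` (`ε ≤ 1/2`) on BOTH arms of `adaptiveShots_floor_uniform`, for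
targets `tA`, `tB` with `2δ < |tA − tB|`, needs `(1−2ε)² ≤ 2·(n ln 2)·N·(1−p)^d` shots.
[cite: TakagiTajimaGu2023, Theorem 3 p.4] (closed-loop schedules; elementary rate) -/
theorem adaptiveShots_floor_of_accuracy {p : ℝ} (hp0 : 0 ≤ p) (hp1 : p ≤ 1) {d : ℕ} {dA dB : R → ℕ}
    (hdA : ∀ r, d ≤ dA r) (hdB : ∀ r, d ≤ dB r)
    {UA : (r : R) → Fin (dA r) → Matrix (ι → Bool) (ι → Bool) ℂ} (hUA : ∀ r t, UA r t ∈ Matrix.unitaryGroup (ι → Bool) ℂ)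
    {UB : (r : R) → Fin (dB r) → Matrix (ι → Bool) (ι → Bool) ℂ} (hUB : ∀ r t, UB r t ∈ Matrix.unitaryGroup (ι → Bool) ℂ)
    {σA σB : R → Matrix (ι → Bool) (ι → Bool) ℂ} (hσA : ∀ r, IsDensity (σA r)) (hσB : ∀ r, IsDensity (σB r))
    (N : ℕ) (S : List (ι → Bool) → R) (g : (Fin N → (ι → Bool)) → ℝ) {tA tB δ ε : ℝ} (hε : ε ≤ 1 / 2)
    (hsep : 2 * δ < |tA - tB|)
    (hAccA : 1 - ε ≤ ∑ x, adaptiveLaw (armLaw fun r => noisyEvolve (p : ℂ) (dA r) (UA r) (σA r)) N S x *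
      (if |g x - tA| ≤ δ then 1 else 0))
    (hAccB : 1 - ε ≤ ∑ x, adaptiveLaw (armLaw fun r => noisyEvolve (p : ℂ) (dB r) (UB r) (σB r)) N S x *
      (if |g x - tB| ≤ δ then 1 else 0)) :
    (1 - 2 * ε) ^ 2 ≤ 2 * (Fintype.card ι * Real.log 2) * N * (1 - p) ^ d := by
  have hB : ∀ r, IsDensity (noisyEvolve (p : ℂ) (dB r) (UB r) (σB r)) :=
    fun r => isDensity_noisyEvolve hp0 hp1 (dB r) (UB r) (hUB r) (hσB r)
  have hRej := window_rejects N _ (adaptiveLaw_nonneg _ (fun r => outcomeProb_nonneg (hB r)) N S)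
    (sum_adaptiveLaw _ (fun r => sum_outcomeProb (hB r)) N S) g hsep hAccB
  exact adaptiveShots_floor_uniform hp0 hp1 hdA hdB hUA hUB hσA hσB N S (fun x => if |g x - tA| ≤ δ then 1 else 0)
    (fun x => by split_ifs <;> norm_num) (fun x => by split_ifs <;> norm_num) hε hAccA hRej

/-! ### §7 Numbers and the small cases -/

/-- `(1 − p)^d ≤ exp (−p d)` for `p ≤ 1`. [folklore] -/
private theorem one_sub_pow_le_exp {p : ℝ} (hp1 : p ≤ 1) (d : ℕ) : (1 - p) ^ d ≤ Real.exp (-(p * d)) := by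
  have h1 : 1 - p ≤ Real.exp (-p) := by have := Real.add_one_le_exp (-p); linarith
  calc (1 - p) ^ d ≤ (Real.exp (-p)) ^ d := pow_le_pow_left₀ (by linarith) h1 d
    _ = Real.exp (-(p * d)) := by rw [← Real.exp_nat_mul]; ring_nf

/-- **Numbers.** `n = 100` qubits, rate `p = 1/100`, menu depth `d = 1000`, error `ε = 1/20`: the floor
`(1 − 2ε)² ≤ 2·(n ln 2)·N·(1−p)^d` forces `N ≥ 129` shots for EVERY closed-loop strategy (`(0.99)^1000 ≤ e^{−10}`,
`0.81·e^{10}/(200 ln 2) > 128`; exact quotient ≈ 135, only the certified 129 is claimed). At `ε = 1/10` the same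
arithmetic is the landed `CoherentCopiesFloor.numbers100` (`N ≥ 102`, not restated here): by design the adaptive,
coherent and open-loop floors give the SAME numbers. VACUITY: at these `n, p, ε` the right side exceeds `0.81` already at
`N = 1` for every `d ≤ 511` — the floor says nothing at or below such depths and then grows like `e^{pd}`.
[cite: TakagiTajimaGu2023, Theorem 3 eq. (5) p.4] (numerical reading at the elementary rate; illustrative constants) -/
theorem numbers129 {N : ℕ}
    (h : (1 - 2 * (1 / 20 : ℝ)) ^ 2 ≤ 2 * ((100 : ℕ) * Real.log 2) * N * (1 - (1 / 100 : ℝ)) ^ 1000) : 129 ≤ N := by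
  by_contra hN
  have hN' : (N : ℝ) ≤ 128 := by exact_mod_cast Nat.lt_succ_iff.mp (not_le.mp hN)
  have h2 : Real.log 2 ≤ 0.6931471808 := Real.log_two_lt_d9.le
  have he : (1 - (1 / 100 : ℝ)) ^ 1000 ≤ 1 / (2.7182818283 : ℝ) ^ 10 := by
    have h1 := one_sub_pow_le_exp (p := (1 / 100 : ℝ)) (by norm_num) 1000
    have h1' : Real.exp (-((1 / 100 : ℝ) * (1000 : ℕ))) = Real.exp (-10) := by norm_num
    rw [h1'] at h1
    refine h1.trans ?_
    rw [Real.exp_neg, one_div]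
    refine inv_anti₀ (by positivity) ?_
    calc (2.7182818283 : ℝ) ^ 10 ≤ (Real.exp 1) ^ 10 := pow_le_pow_left₀ (by norm_num) Real.exp_one_gt_d9.le 10
      _ = Real.exp 10 := by rw [← Real.exp_nat_mul]; norm_num
  generalize hq : (1 - (1 / 100 : ℝ)) ^ 1000 = q at h he
  have hq0 : 0 ≤ q := by rw [← hq]; positivity
  have hl0 : 0 < Real.log 2 := Real.log_pos one_lt_two
  have h3 : 2 * ((100 : ℕ) * Real.log 2) * N * q ≤ 2 * (100 * 0.6931471808) * 128 * (1 / (2.7182818283 : ℝ) ^ 10) := by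
    push_cast
    gcongr
  have h4 : 2 * (100 * 0.6931471808) * 128 * (1 / (2.7182818283 : ℝ) ^ 10) < (1 - 2 * (1 / 20 : ℝ)) ^ 2 := by
    norm_num
  linarith

-- The two-shot case of the object: the second request DEPENDS on the first read-out (cheapest falsifier of the
-- recursion — if `S` ignored its argument this would be a product law).
example (a : R → (ι → Bool) → ℝ) (S : List (ι → Bool) → R) (x : Fin 2 → (ι → Bool)) :
    adaptiveLaw a 2 S x = a (S []) (x 0) * a (S [x 0]) (x 1) := by
  simp [adaptiveLaw, Fin.tail]

-- The one-shot case of the chain rule: `D(P ‖ u) = D(a (S []) ‖ u)` (no adaptivity possible).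
example (a : R → (ι → Bool) → ℝ) (ha1 : ∀ r, ∑ x, a r x = 1) (S : List (ι → Bool) → R) :
    klUnif 1 (adaptiveLaw a 1 S) = klOne (a (S [])) := by
  rw [klUnif_succ a ha1 0 S]
  simp [klUnif, adaptiveLaw, unifLaw]

-- The two-shot case of the chain rule, with the history-dependent second term written out.
example (a : R → (ι → Bool) → ℝ) (ha1 : ∀ r, ∑ x, a r x = 1) (S : List (ι → Bool) → R) :
    klUnif 2 (adaptiveLaw a 2 S) = klOne (a (S [])) + ∑ x₀, a (S []) x₀ * klOne (a (S [x₀])) := by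
  rw [klUnif_succ a ha1 1 S]
  congr 1
  refine Finset.sum_congr rfl fun x₀ _ => ?_
  rw [klUnif_succ a ha1 0]
  simp [klUnif, adaptiveLaw, unifLaw]

end AdaptiveShotsFloor

end Literature.Computability.QuantumComplexity
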